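import Summits.AtomisticToContinuum.Crystallization.Theorems.PhononSlackCertificatesPeriodicGivenLayeredRegistry
import Summits.AtomisticToContinuum.Crystallization.Theorems.PhononSlackCertificatesPeriodicGivenLayeredClosing2
import Summits.AtomisticToContinuum.Crystallization.Theorems.PhononSlackCertificatesPeriodicGivenLayeredLayerCake3

/-!
# Crux `HcpLandscapeGap` (route `HullExactificationCascade`, stmt-AtomisticToContinuum-12087),
# line `birth`: stub `stub_registryMajorisationHeights` (RC-W2) — registry majorisation at mixed
# heights, per site, with the fault price on BOTH sides

STUB RC-W2 of the skeleton `Cruxes/HcpLandscapeGap/Lines/birth.lean` (v10/v11, the relaxed-Barlow cut).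
For `a ∈ [47/50, 1]`, a Hägg word `s`, heights `z : ℤ → ℝ` with every spacing in `[39a/50, 17a/20]`
and a layer `m`, the full layer series of the ACTUAL registry pattern seen from layer `m`,
`Σ'_{k ≠ m} Φ(z k − z m, L_s k − L_s m)` (`Φ(H, δ) = layerInteraction V_LJ a H δ 1`,
`L_s = haggLabel s`), dominates the series of the ALTERNATING (hcp) pattern at the SAME heights,
`Σ'_{k ≠ m} Φ(z k − z m, 0 if k − m even else 1)`, plus `c₀` per adjacent cubic bond: `s (m+1) = s m`
(fault above `m`) and `s (m−1) = s (m−2)` (fault below `m`). The constant `c₀ > 0` is the corner gap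
of `LayeredHull.stub_registry`.

Proof (a re-assembly of `LayeredHull.clo_layer_price`, which prices only the fault above).
* The parity offset `0/1` and the hcp label offset `L_alt k − L_alt m ∈ {−1, 0, 1}` give the same
  layer interaction (`haggLabel_alternating`, `layerInteraction_neg_offset`), so the alternating
  series is the `alternatingHagg` instance of the actual one; both series are summable by
  `LayeredHull.cake_summable_layers` (decay `|Φ| ≤ 192/H⁴`, gaps `≥ 39a/50`).
* Split the difference of the two `ℤ`-series at `m` (`LayeredHull.clo_tsum_int_split`). Above,
  the terms are the masked couplings `J k = D_a(z (m+k) − z m)`, `D_a(H) = barlowCoupling V_LJ a H 1`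
  (`LayeredHull.clo_diff_above`), and the sum is `haggLocalEnergy J s m − haggLocalEnergy J alt m`;
  below, with `J' k = D_a(z m − z (m−k))` (evenness in the height, `LayeredHull.clo_diff_below`), it
  is the difference of the backward energies, i.e. of the FORWARD energies of the reflected word
  `n ↦ s (2m − 1 − n)` (`LayeredHull.clo_haggBackwardLocalEnergy_eq_reflect`,
  `LayeredHull.clo_haggBackwardLocalEnergy_alternating`).
* `LayeredHull.clo_coupling_facts` (from `stub_registry`: `D_a ≤ 0` and non-decreasing on
  `[39a/25, ∞)`, corner gap `c₀ ≤ D_a(117a/50) − D_a(17a/10)`) makes `J`, `J'` summable, `≤ 0`,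
  non-decreasing from `k = 2` on, with `c₀ ≤ J 3 − J 2`, `c₀ ≤ J' 3 − J' 2`; the Bétermin–Petrache
  pairing majorisation `LayeredHull.clo_forward_price` (for `s` and for the reflected word) then
  pays `c₀·1[s (m+1) ≠ −s m]` above and `c₀·1[s (m−2) ≠ −s (m−1)]` below, and for a `±1`-valued
  word `s i ≠ −s j ↔ s i = s j`.
All `[folklore]` given the cited inputs.
-/

noncomputable section

namespace Summit.AtomisticToContinuum.Crystallization.Theorems.HcpLandscapeGapBirth

open Literature.MathematicalPhysics.StatisticalMechanics
open Summit.AtomisticToContinuum.Crystallization.Theorems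
open Summit.AtomisticToContinuum.Crystallization.Theorems.LayeredHull

namespace RegistryMajorisationHeights

/-- For a `±1`-valued word, "no alternation" is "repetition": the fault indicator
`1[s i ≠ −s j]` equals `1[s i = s j]`. [folklore] -/
theorem ite_fault_eq {s : ℤ → ℤ} (hs : IsHaggSeq s) (i j : ℤ) :
    (if s i = -s j then (0 : ℝ) else 1) = if s i = s j then 1 else 0 := by
  rcases hs i with h1 | h1 <;> rcases hs j with h2 | h2 <;> rw [h1, h2] <;> norm_num

/-- **Parity offset = hcp label offset.** Seen from layer `m`, the alternating (hcp) registry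
pattern at layer `k` is the offset `0` if `k − m` is even and `1` otherwise; the label offset
`L_alt k − L_alt m ∈ {−1, 0, 1}` of the alternating word gives the same layer interaction
(`Φ` is even in the offset). [folklore] -/
theorem layerInteraction_parity_eq (V : ℝ → ℝ) (a H : ℝ) (k m : ℤ) :
    layerInteraction V a H (if Even (k - m) then 0 else 1) 1 =
      layerInteraction V a H (haggLabel alternatingHagg k - haggLabel alternatingHagg m) 1 := by
  rw [haggLabel_alternating, haggLabel_alternating]
  by_cases hk : Even k <;> by_cases hm : Even m
  · have hkm : Even (k - m) := Int.even_sub.2 (iff_of_true hk hm)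
    rw [if_pos hk, if_pos hm, if_pos hkm, sub_zero]
  · have hkm : ¬ Even (k - m) := fun h => hm ((Int.even_sub.1 h).1 hk)
    rw [if_pos hk, if_neg hm, if_neg hkm, zero_sub, layerInteraction_neg_offset]
  · have hkm : ¬ Even (k - m) := fun h => hk ((Int.even_sub.1 h).2 hm)
    rw [if_neg hk, if_pos hm, if_neg hkm, sub_zero]
  · have hkm : Even (k - m) := Int.even_sub.2 (iff_of_false hk hm)
    rw [if_neg hk, if_neg hm, if_pos hkm, sub_self]

/-- **Two-sided layer price at free heights.** For `a ≥ 47/50`, a Hägg word `s`, admissible heights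
`z`, the registry facts (`D_a ≤ 0`, non-decreasing on `[39a/25, ∞)`, corner gap `c₀`) and the decay
`|Φ(H, δ)| ≤ C/H⁴` (`|H| ≥ 7/10`): if the actual and the alternating layer series of layer `m` are
summable, their difference is at least `c₀·(1[s (m+1) = s m] + 1[s (m−1) = s (m−2)])`
(`clo_layer_price` with the fault below `m` priced as well, via the reflected word). [folklore] -/
theorem layer_price_two_sided {a : ℝ} (ha : 47 / 50 ≤ a) {s : ℤ → ℤ} (hs : IsHaggSeq s) {z : ℤ → ℝ}
    (hz : ∀ m : ℤ, 39 / 50 * a ≤ z (m + 1) - z m ∧ z (m + 1) - z m ≤ 17 / 20 * a) {C c₀ : ℝ}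
    (hdecay : ∀ (H : ℝ) (δ : ℤ), 7 / 10 ≤ |H| → |layerInteraction lennardJones a H δ 1| ≤ C / H ^ 4)
    (hreg1 : ∀ H H' : ℝ, 39 / 25 * a ≤ H → H ≤ H' →
      barlowCoupling lennardJones a H' 1 ≤ 0 ∧
        barlowCoupling lennardJones a H 1 ≤ barlowCoupling lennardJones a H' 1)
    (hreg2 : c₀ ≤ barlowCoupling lennardJones a (117 / 50 * a) 1 -
      barlowCoupling lennardJones a (17 / 10 * a) 1)
    (m : ℤ)
    (hsum_s : Summable fun m' : ℤ => if m' = m then (0 : ℝ) else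
      layerInteraction lennardJones a (z m' - z m) (haggLabel s m' - haggLabel s m) 1)
    (hsum_a : Summable fun m' : ℤ => if m' = m then (0 : ℝ) else
      layerInteraction lennardJones a (z m' - z m)
        (haggLabel alternatingHagg m' - haggLabel alternatingHagg m) 1) :
    c₀ * ((if s (m + 1) = s m then (1 : ℝ) else 0) + (if s (m - 1) = s (m - 2) then (1 : ℝ) else 0)) ≤
      (∑' m' : ℤ, if m' = m then (0 : ℝ) else
        layerInteraction lennardJones a (z m' - z m) (haggLabel s m' - haggLabel s m) 1) -
      (∑' m' : ℤ, if m' = m then (0 : ℝ) else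
        layerInteraction lennardJones a (z m' - z m)
          (haggLabel alternatingHagg m' - haggLabel alternatingHagg m) 1) := by
  -- coupling facts above (`J`) and below (`J'`)
  obtain ⟨hJs, hJ0, hJmono, hJc⟩ := clo_coupling_facts ha hdecay hreg1 hreg2
    (fun k : ℕ => z (m + k) - z m) (clo_height_add hz m) (fun k => by
      have := (hz (m + k)).1
      have ha0 : 0 ≤ a := by linarith
      push_cast; rw [← add_assoc]; nlinarith)
  obtain ⟨hJ's, hJ'0, hJ'mono, hJ'c⟩ := clo_coupling_facts ha hdecay hreg1 hreg2
    (fun k : ℕ => z m - z (m - k)) (clo_height_sub hz m) (fun k => by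
      have := (hz (m - (k + 1 : ℕ))).1
      have ha0 : 0 ≤ a := by linarith
      push_cast at this ⊢
      rw [show m - ((k : ℤ) + 1) + 1 = m - k by ring] at this
      nlinarith)
  -- one `ℤ`-sum, split at `m`
  rw [← hsum_s.tsum_sub hsum_a, clo_tsum_int_split _ m (hsum_s.sub hsum_a)]
  -- the layers above: `haggLocalEnergy J s m − haggLocalEnergy J alt m`
  have hup : ∑' n : ℕ, ((if m + (n : ℤ) = m then (0 : ℝ) else
        layerInteraction lennardJones a (z (m + n) - z m) (haggLabel s (m + n) - haggLabel s m) 1) -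
      (if m + (n : ℤ) = m then (0 : ℝ) else
        layerInteraction lennardJones a (z (m + n) - z m)
          (haggLabel alternatingHagg (m + n) - haggLabel alternatingHagg m) 1)) =
      haggLocalEnergy (fun k : ℕ => barlowCoupling lennardJones a (z (m + k) - z m) 1) s m -
        haggLocalEnergy (fun k : ℕ => barlowCoupling lennardJones a (z (m + k) - z m) 1)
          alternatingHagg m := by
    unfold haggLocalEnergy
    rw [← (summable_ite_of_summable hJs _).tsum_sub (summable_ite_of_summable hJs _)]
    exact tsum_congr fun n => clo_diff_above hs z m n
  -- the layers below: `haggBackwardLocalEnergy J' s m − haggBackwardLocalEnergy J' alt m`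
  have hdown : ∑' n : ℕ, ((if m - ((n + 1 : ℕ) : ℤ) = m then (0 : ℝ) else
        layerInteraction lennardJones a (z (m - (n + 1 : ℕ)) - z m)
          (haggLabel s (m - (n + 1 : ℕ)) - haggLabel s m) 1) -
      (if m - ((n + 1 : ℕ) : ℤ) = m then (0 : ℝ) else
        layerInteraction lennardJones a (z (m - (n + 1 : ℕ)) - z m)
          (haggLabel alternatingHagg (m - (n + 1 : ℕ)) - haggLabel alternatingHagg m) 1)) =
      haggBackwardLocalEnergy (fun k : ℕ => barlowCoupling lennardJones a (z m - z (m - k)) 1) s m -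
        haggBackwardLocalEnergy (fun k : ℕ => barlowCoupling lennardJones a (z m - z (m - k)) 1)
          alternatingHagg m := by
    have hS1 : Summable fun n : ℕ => (if HaggAligned s (m - (n + 1 : ℕ)) (n + 1) then
        barlowCoupling lennardJones a (z m - z (m - (n + 1 : ℕ))) 1 else 0) :=
      (summable_nat_add_iff (f := fun k : ℕ =>
        if HaggAligned s (m - k) k then barlowCoupling lennardJones a (z m - z (m - k)) 1 else 0) 1).2
        (summable_ite_of_summable hJ's _)
    have hS2 : Summable fun n : ℕ => (if HaggAligned alternatingHagg (m - (n + 1 : ℕ)) (n + 1) then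
        barlowCoupling lennardJones a (z m - z (m - (n + 1 : ℕ))) 1 else 0) :=
      (summable_nat_add_iff (f := fun k : ℕ =>
        if HaggAligned alternatingHagg (m - k) k then
          barlowCoupling lennardJones a (z m - z (m - k)) 1 else 0) 1).2
        (summable_ite_of_summable hJ's _)
    rw [tsum_congr (fun n => clo_diff_below (a := a) s z m n), hS1.tsum_sub hS2,
      tsum_ite_succ_eq (P := fun k => HaggAligned s (m - k) k) (not_haggAligned_one hs _)
        (fun k : ℕ => barlowCoupling lennardJones a (z m - z (m - k)) 1),
      tsum_ite_succ_eq (P := fun k => HaggAligned alternatingHagg (m - k) k)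
        (not_haggAligned_one isHaggSeq_alternating _)
        (fun k : ℕ => barlowCoupling lennardJones a (z m - z (m - k)) 1)]
    simp only [haggBackwardLocalEnergy]
  rw [hup, hdown, clo_haggBackwardLocalEnergy_eq_reflect _ s m, clo_haggBackwardLocalEnergy_alternating]
  -- forward prices of `s` (fault above `m`) and of the reflected word (fault below `m`)
  have hf := clo_forward_price hs hJs hJ0 hJmono hJc m
  have hb := clo_forward_price (clo_isHaggSeq_reflect hs m) hJ's hJ'0 hJ'mono hJ'c m
  have e1 : (if s (m + 1) = -s m then (0 : ℝ) else 1) = if s (m + 1) = s m then 1 else 0 :=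
    ite_fault_eq hs _ _
  have e2 : (if s (2 * m - 1 - (m + 1)) = -s (2 * m - 1 - m) then (0 : ℝ) else 1) =
      if s (m - 1) = s (m - 2) then 1 else 0 := by
    rw [show 2 * m - 1 - (m + 1) = m - 2 by ring, show 2 * m - 1 - m = m - 1 by ring,
      ite_fault_eq hs (m - 2) (m - 1)]
    by_cases h : s (m - 1) = s (m - 2)
    · rw [if_pos h, if_pos h.symm]
    · rw [if_neg h, if_neg (fun h' => h h'.symm)]
  simp only [e1] at hf
  simp only [e2] at hb
  linarith

end RegistryMajorisationHeights

open RegistryMajorisationHeights in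
/-- **Stub RC-W2 — registry majorisation at mixed heights, per site.** There is `c₀ > 0` (the corner
gap of `LayeredHull.stub_registry`) such that for `a ∈ [47/50, 1]`, a Hägg word `s`, heights `z`
with spacings in `[39a/50, 17a/20]` and a layer `m`: the alternating-pattern layer series
`Σ'_{k ≠ m} Φ(z k − z m, 0 if k − m even else 1)` is summable, and together with `c₀` per adjacent
cubic bond (`s (m+1) = s m` above, `s (m−1) = s (m−2)` below) it is at most the actual-pattern
series `Σ'_{k ≠ m} Φ(z k − z m, haggLabel s k − haggLabel s m)` (`Φ(H, δ) = layerInteraction V_LJ a H δ 1`).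
Proof: the parity offset is the hcp label offset (`layerInteraction_parity_eq`), both series are
summable by `LayeredHull.cake_summable_layers`, and `layer_price_two_sided` (registry facts from
`LayeredHull.stub_registry`, decay from `LayeredHull.cake_abs_layerInteraction_le`). [folklore] -/
theorem stub_registryMajorisationHeights : ∃ c₀ : ℝ, 0 < c₀ ∧ ∀ (a : ℝ), 47 / 50 ≤ a → a ≤ 1 → ∀ s : ℤ → ℤ, Literature.MathematicalPhysics.StatisticalMechanics.IsHaggSeq s → ∀ z : ℤ → ℝ, (∀ k : ℤ, 39 / 50 * a ≤ z (k + 1) - z k ∧ z (k + 1) - z k ≤ 17 / 20 * a) → ∀ m : ℤ, Summable (fun k : ℤ => if k = m then (0 : ℝ) else Literature.MathematicalPhysics.StatisticalMechanics.layerInteraction Literature.MathematicalPhysics.StatisticalMechanics.lennardJones a (z k - z m) (if Even (k - m) then 0 else 1) 1) ∧ (∑' k : ℤ, (if k = m then (0 : ℝ) else Literature.MathematicalPhysics.StatisticalMechanics.layerInteraction Literature.MathematicalPhysics.StatisticalMechanics.lennardJones a (z k - z m) (if Even (k - m) then 0 else 1) 1)) + c₀ * ((if s (m + 1) = s m then (1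 : ℝ) else 0) + (if s (m - 1) = s (m - 2) then (1 : ℝ) else 0)) ≤ ∑' k : ℤ, (if k = m then (0 : ℝ) else Literature.MathematicalPhysics.StatisticalMechanics.layerInteraction Literature.MathematicalPhysics.StatisticalMechanics.lennardJones a (z k - z m) (Literature.MathematicalPhysics.StatisticalMechanics.haggLabel s k - Literature.MathematicalPhysics.StatisticalMechanics.haggLabel s m) 1) := by
  obtain ⟨c₀, hc₀, hR⟩ := stub_registry
  refine ⟨c₀, hc₀, ?_⟩
  intro a ha ha1 s hs z hz m
  obtain ⟨hreg1, hreg2⟩ := hR a ha ha1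
  have hz1 : ∀ k : ℤ, 39 / 50 * a ≤ z (k + 1) - z k := fun k => (hz k).1
  have hdecay : ∀ (H : ℝ) (δ : ℤ), 7 / 10 ≤ |H| →
      |layerInteraction lennardJones a H δ 1| ≤ 192 / H ^ 4 :=
    fun H δ hH => cake_abs_layerInteraction_le a H ha ha1 hH δ
  have hsum_s := cake_summable_layers a ha ha1 s z hz1 m
  have hsum_a := cake_summable_layers a ha ha1 alternatingHagg z hz1 m
  -- the parity form of the alternating series is its hcp-label form
  simp only [layerInteraction_parity_eq]
  refine ⟨hsum_a, ?_⟩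
  have h := layer_price_two_sided ha hs hz hdecay hreg1 hreg2 m hsum_s hsum_a
  linarith

end Summit.AtomisticToContinuum.Crystallization.Theorems.HcpLandscapeGapBirth

end
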